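import Literature.AlgebraicGeometry.Motives.HodgeThetaSubalgebraUnitaryEightCore
import HarnessLib

/-!
# The `Θ`-subalgebra theorem for unitary multiplicities `(10, b)`, `b ∈ {1, 3, 7, 11, 13}` — complex–Hermitian,
# classification-free (Ribet 1983 Thm. 3, Lie step; `23 = 10 + 13`)

Family `hodge`, layer `Literature/AlgebraicGeometry/Motives` (pure linear algebra over `ℂ`; no geometry). Research
context: cell `pub-hodge-ring2` (HONEST FRAMING: research route conditional on HC_CM; not a corollary; Q11.4-sentence-2
already refuted in dim ≥ 3), Literature lane gen 84, programme R68. UNCONDITIONAL; theorems only, no definition, no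
named fact (D-0026), no `sorry`.

* §1 **`UnitaryTen.exists_raise_onto_ten_of_smul`** — `dim P = 10`, `dim Q ∈ {11, 13, 19}` ⟹ a raising operator of `𝔊`
  maps onto `P`. Ranks `2, 4, 5, 6, 8 → +1` by the Φ-route with the Levi cores `(2 | odd)`, `(4 | odd)`, `(5 | b − 5)`,
  `(6 | b − 6)`, `(8 | b − 8)` (`b − 8 ∈ {3, 5, 11}`: `UnitaryEight.eq_top_of_smul`); ranks `3, 7 → +1` by the Ψ-core route
  with the cores `(7 | 3)`, `(3 | 7)`; rank `9 → 10` by the triple route (`m (10 − ρ) = 9 ρ` has no solution for these `b`).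
* §2 **`UnitaryTen.eq_top_of_smul`** — the `(10 | b)` core for `b` odd, `b ≤ 13`, `5 ∤ b`, `b ≠ 9` (i.e. `b ∈ {1, 3, 7, 11,
  13}`; bases by the mirrored `(1 | ·)`, `(3 | ·)`, `(7 | ·)` cores, `b = 11, 13` by one Euclid step onto `(10 | 1)`,
  `(10 | 3)`), and the mirror `eq_top_of_smul'`. NEW: `(10, 13)` — the `23`-fold cell `{10, 13}`.

HONEST SCOPE: `(10 | 9)` = `(9 | 10)` is a stall of the method (rank `6`, see `HodgeThetaSubalgebraUnitaryEightCore`),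
so `(10 | 19)` (`19 − 10 = 9`) is not reached although §1 holds at `b = 19`; `(10 | 17)` stalls at rank `8` (`(8 | 9)`),
`(10 | 21)` at rank `6`.

## References
* [Ribet1983] K. A. Ribet, *Hodge classes on certain types of abelian varieties*, Amer. J. Math. 105 (1983), Thm. 3
  (= [Gordon1997, Thm. 6.3 (3)], held `paper:arxiv-alg-geom_9709030` pp. 18–19).
* [Deligne1982HodgeCycles] P. Deligne, *Hodge cycles on abelian varieties*, LNM 900 (1982), I §3 Prop. 3.4, 3.6.
* [GoodmanWallachGTM255] R. Goodman, N. R. Wallach, GTM 255 (2009), §4.1.1, §3.3.2.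
-/

noncomputable section

namespace Literature.AlgebraicGeometry.Motives

namespace HodgeStructure

/-! ### §1 The rank-ten raising lemma -/

section RankTen

universe u

variable {W : Type u} [AddCommGroup W] [Module ℂ W]

/-- **The rank-ten raising lemma at `dim Q ∈ {11, 13, 19}`** (`dim P = 10`; the Hermitian form `ℂ`-homogeneous in the
first slot). [cite: Ribet1983, Thm. 3] [cite: Gordon1997, Thm. 6.3 (3)] [cite: Deligne1982HodgeCycles, I §3 Prop. 3.6] -/
theorem UnitaryTen.exists_raise_onto_ten_of_smul [FiniteDimensional ℂ W] {𝔊 : Submodule ℂ (Module.End ℂ W)}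
    (hbr : ∀ Y ∈ 𝔊, ∀ Z ∈ 𝔊, Y * Z - Z * Y ∈ 𝔊)
    (hirr : ∀ U : Submodule ℂ W, (∀ A ∈ 𝔊, ∀ u ∈ U, A u ∈ U) → U = ⊥ ∨ U = ⊤)
    {Θ : Module.End ℂ W} (hΘ : Θ ∈ 𝔊) (hΘΘ : Θ * Θ = 1)
    {P Q : Submodule ℂ W} (hP : ∀ x, x ∈ P ↔ Θ x = x) (hQ : ∀ x, x ∈ Q ↔ Θ x = -x)
    (hP10 : Module.finrank ℂ P = 10)
    (hQb : Module.finrank ℂ Q = 11 ∨ Module.finrank ℂ Q = 13 ∨ Module.finrank ℂ Q = 19)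
    {s : W → W → ℂ} (hadd : ∀ x y z, s (x + y) z = s x z + s y z)
    (hsmul : ∀ (c : ℂ) (x y : W), s (c • x) y = c * s x y) (hsymm : ∀ x y, s y x = starRingEnd ℂ (s x y))
    (hPQ : ∀ p ∈ P, ∀ q ∈ Q, s p q = 0) (hdefP : ∀ p ∈ P, s p p = 0 → p = 0) (hdefQ : ∀ q ∈ Q, s q q = 0 → q = 0)
    (hadj : ∀ X ∈ 𝔊, ∃ Y ∈ 𝔊, ∀ x y, s (X x) y = s x (Y y)) :
    ∃ B ∈ 𝔊, Θ * B = B ∧ B * Θ = -B ∧ ∀ p ∈ P, ∃ w, B w = p := by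
  classical
  have hraiseval : ∀ Z : Module.End ℂ W, Θ * Z = Z → ∀ w, Z w ∈ P := fun Z hΘZ w =>
    (hP _).2 (by rw [← Module.End.mul_apply, hΘZ])
  have hle : ∀ B' : Module.End ℂ W, Θ * B' = B' → Module.finrank ℂ (LinearMap.range B') ≤ 10 := fun B' h => by
    rw [← hP10]
    exact Submodule.finrank_mono (by rintro _ ⟨w, rfl⟩; exact hraiseval B' h w)
  have honto : ∀ B' : Module.End ℂ W, Θ * B' = B' → 10 ≤ Module.finrank ℂ (LinearMap.range B') →
      ∀ p ∈ P, ∃ w, B' w = p := by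
    intro B' hΘB' h10 p hp
    have hle' : LinearMap.range B' ≤ P := by rintro _ ⟨w, rfl⟩; exact hraiseval B' hΘB' w
    have heq : LinearMap.range B' = P := Submodule.eq_of_le_of_finrank_le hle' (by rw [hP10]; exact h10)
    have hp' : p ∈ LinearMap.range B' := heq ▸ hp
    exact hp'
  have hup : ∀ B' ∈ 𝔊, Θ * B' = B' → B' * Θ = -B' →
      2 ≤ Module.finrank ℂ (LinearMap.range B') → Module.finrank ℂ (LinearMap.range B') ≤ 9 →
      ∃ B'' ∈ 𝔊, Θ * B'' = B'' ∧ B'' * Θ = -B'' ∧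
        Module.finrank ℂ (LinearMap.range B') < Module.finrank ℂ (LinearMap.range B'') := by
    intro B' hB' hΘB' hB'Θ h2 h9
    by_cases hr9 : Module.finrank ℂ (LinearMap.range B') = 9
    · -- triple route: `m (10 − ρ) = 9 ρ` forces `dim Q ∈ {10, 15, 18, 30, 45}`
      refine UnitaryRaisingRank.exists_raise_rank_gt_of_finrank_eq_succ_of_smul hbr hirr hΘ hΘΘ hP hQ hB' hΘB' hB'Θ
        (by omega) (by rw [hr9, hP10]) (by omega) (fun ρ hρ1 hρr => ?_) hadd hsmul hsymm hPQ hdefP hdefQ hadj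
      rw [hr9] at hρr ⊢
      rcases hQb with h | h | h <;> (rw [h]; interval_cases ρ <;> omega)
    by_cases hr37 : Module.finrank ℂ (LinearMap.range B') = 3 ∨ Module.finrank ℂ (LinearMap.range B') = 7
    · -- ranks `3`, `7`: Ψ-core route with the cores `(7 | 3)`, `(3 | 7)`
      refine UnitaryRaisingRank.exists_raise_rank_gt_of_psi_core hbr hirr hΘ hΘΘ hP hQ hB' hΘB' hB'Θ (by omega)
        (by omega) (by omega) hadd hsymm hPQ hdefP hdefQ hadj fun U 𝔩 ι P' Q' hbr𝔩 hirr𝔩 hι hιι hP' hQ' hfinP' hfinQ'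
          hP'Q' hdefP' hdefQ' hadj𝔩 => ?_
      rcases hr37 with hr3 | hr7
      · exact UnitaryThreeCoprime.eq_top' hbr𝔩 hirr𝔩 hι hιι hP' hQ' (by omega) (by rw [hfinQ', hr3])
          (s := fun x y : U => s (x : W) y) (fun x y z => by simp only [Submodule.coe_add, hadd])
          (fun x y => hsymm x y) hP'Q' hdefP' hdefQ' hadj𝔩
      · exact UnitaryThreeCoprime.eq_top hbr𝔩 hirr𝔩 hι hιι hP' hQ' (by omega) (by rw [hfinQ', hr7]; omega)
          (s := fun x y : U => s (x : W) y) (fun x y z => by simp only [Submodule.coe_add, hadd])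
          (fun x y => hsymm x y) hP'Q' hdefP' hdefQ' hadj𝔩
    · -- ranks `2`, `4`, `5`, `6`, `8`: Φ-route with the cores `(2 | odd)`, `(4 | odd)`, `(5 | ·)`, `(6 | ·)`, `(8 | ·)`
      push Not at hr37
      refine UnitaryRaisingRank.exists_raise_rank_gt_of_two_le hbr hirr hΘ hΘΘ hP hQ hadd hsymm hPQ hdefP hdefQ
        hadj hB' hΘB' hB'Θ (by omega) (by omega) (by omega) fun U 𝔩 ι P' Q' hbr𝔩 hirr𝔩 hι hιι hP' hQ' hfinP' hfinQ'
          hP'Q' hdefP' hdefQ' hadj𝔩 => ?_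
      by_cases hr2 : Module.finrank ℂ (LinearMap.range B') = 2
      · exact UnitaryTwoOdd.eq_top hbr𝔩 hirr𝔩 hι hιι hP' hQ' (by rw [hfinP', hr2])
          ⟨Module.finrank ℂ Q' / 2, by omega⟩
          (s := fun x y : U => s (x : W) y) (fun x y z => by simp only [Submodule.coe_add, hadd])
          (fun x y => hsymm x y) hP'Q' hdefP' hdefQ' hadj𝔩
      by_cases hr4 : Module.finrank ℂ (LinearMap.range B') = 4
      · exact UnitaryFourOdd.eq_top hbr𝔩 hirr𝔩 hι hιι hP' hQ' (by rw [hfinP', hr4])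
          ⟨Module.finrank ℂ Q' / 2, by omega⟩
          (s := fun x y : U => s (x : W) y) (fun x y z => by simp only [Submodule.coe_add, hadd])
          (fun x y => hsymm x y) hP'Q' hdefP' hdefQ' hadj𝔩
      by_cases hr5 : Module.finrank ℂ (LinearMap.range B') = 5
      · exact UnitaryFive.eq_top_of_smul hbr𝔩 hirr𝔩 hι hιι hP' hQ' (by rw [hfinP', hr5]) (by omega)
          (s := fun x y : U => s (x : W) y) (fun x y z => by simp only [Submodule.coe_add, hadd])
          (fun c x y => by simp only [Submodule.coe_smul, hsmul]) (fun x y => hsymm x y) hP'Q' hdefP' hdefQ' hadj𝔩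
      by_cases hr6 : Module.finrank ℂ (LinearMap.range B') = 6
      · exact UnitarySix.eq_top_of_smul hbr𝔩 hirr𝔩 hι hιι hP' hQ' (by rw [hfinP', hr6])
          ⟨Module.finrank ℂ Q' / 2, by omega⟩ (by omega)
          (s := fun x y : U => s (x : W) y) (fun x y z => by simp only [Submodule.coe_add, hadd])
          (fun c x y => by simp only [Submodule.coe_smul, hsmul]) (fun x y => hsymm x y) hP'Q' hdefP' hdefQ' hadj𝔩
      · have hr8 : Module.finrank ℂ (LinearMap.range B') = 8 := by omega
        exact UnitaryEight.eq_top_of_smul hbr𝔩 hirr𝔩 hι hιι hP' hQ' (by rw [hfinP', hr8])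
          ⟨Module.finrank ℂ Q' / 2, by omega⟩ (by omega) (by omega)
          (s := fun x y : U => s (x : W) y) (fun x y z => by simp only [Submodule.coe_add, hadd])
          (fun c x y => by simp only [Submodule.coe_smul, hsmul]) (fun x y => hsymm x y) hP'Q' hdefP' hdefQ' hadj𝔩
  obtain ⟨B₂, hB₂, hΘB₂, hB₂Θ, hrk₂⟩ :=
    UnitaryThreeCoprime.exists_raise_rank_ge_two hbr hirr hΘ hΘΘ hP hQ (by omega) (by omega)
  have h₂ := hle B₂ hΘB₂
  by_cases h10 : 10 ≤ Module.finrank ℂ (LinearMap.range B₂)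
  · exact ⟨B₂, hB₂, hΘB₂, hB₂Θ, honto B₂ hΘB₂ h10⟩
  obtain ⟨B₃, hB₃, hΘB₃, hB₃Θ, hrk₃⟩ := hup B₂ hB₂ hΘB₂ hB₂Θ hrk₂ (by omega)
  have h₃ := hle B₃ hΘB₃
  by_cases h10' : 10 ≤ Module.finrank ℂ (LinearMap.range B₃)
  · exact ⟨B₃, hB₃, hΘB₃, hB₃Θ, honto B₃ hΘB₃ h10'⟩
  obtain ⟨B₄, hB₄, hΘB₄, hB₄Θ, hrk₄⟩ := hup B₃ hB₃ hΘB₃ hB₃Θ (by omega) (by omega)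
  have h₄ := hle B₄ hΘB₄
  by_cases h10'' : 10 ≤ Module.finrank ℂ (LinearMap.range B₄)
  · exact ⟨B₄, hB₄, hΘB₄, hB₄Θ, honto B₄ hΘB₄ h10''⟩
  obtain ⟨B₅, hB₅, hΘB₅, hB₅Θ, hrk₅⟩ := hup B₄ hB₄ hΘB₄ hB₄Θ (by omega) (by omega)
  have h₅ := hle B₅ hΘB₅
  by_cases h10''' : 10 ≤ Module.finrank ℂ (LinearMap.range B₅)
  · exact ⟨B₅, hB₅, hΘB₅, hB₅Θ, honto B₅ hΘB₅ h10'''⟩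
  obtain ⟨B₆, hB₆, hΘB₆, hB₆Θ, hrk₆⟩ := hup B₅ hB₅ hΘB₅ hB₅Θ (by omega) (by omega)
  have h₆ := hle B₆ hΘB₆
  by_cases h10'''' : 10 ≤ Module.finrank ℂ (LinearMap.range B₆)
  · exact ⟨B₆, hB₆, hΘB₆, hB₆Θ, honto B₆ hΘB₆ h10''''⟩
  obtain ⟨B₇, hB₇, hΘB₇, hB₇Θ, hrk₇⟩ := hup B₆ hB₆ hΘB₆ hB₆Θ (by omega) (by omega)
  have h₇ := hle B₇ hΘB₇
  by_cases h10''''' : 10 ≤ Module.finrank ℂ (LinearMap.range B₇)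
  · exact ⟨B₇, hB₇, hΘB₇, hB₇Θ, honto B₇ hΘB₇ h10'''''⟩
  obtain ⟨B₈, hB₈, hΘB₈, hB₈Θ, hrk₈⟩ := hup B₇ hB₇ hΘB₇ hB₇Θ (by omega) (by omega)
  have h₈ := hle B₈ hΘB₈
  by_cases h10'''''' : 10 ≤ Module.finrank ℂ (LinearMap.range B₈)
  · exact ⟨B₈, hB₈, hΘB₈, hB₈Θ, honto B₈ hΘB₈ h10''''''⟩
  obtain ⟨B₉, hB₉, hΘB₉, hB₉Θ, hrk₉⟩ := hup B₈ hB₈ hΘB₈ hB₈Θ (by omega) (by omega)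
  have h₉ := hle B₉ hΘB₉
  by_cases h10''''''' : 10 ≤ Module.finrank ℂ (LinearMap.range B₉)
  · exact ⟨B₉, hB₉, hΘB₉, hB₉Θ, honto B₉ hΘB₉ h10'''''''⟩
  obtain ⟨B₁₀, hB₁₀, hΘB₁₀, hB₁₀Θ, hrk₁₀⟩ := hup B₉ hB₉ hΘB₉ hB₉Θ (by omega) (by omega)
  have h₁₀ := hle B₁₀ hΘB₁₀
  exact ⟨B₁₀, hB₁₀, hΘB₁₀, hB₁₀Θ, honto B₁₀ hΘB₁₀ (by omega)⟩

end RankTen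

/-! ### §2 The `(10 | b)` core for `b ∈ {1, 3, 7, 11, 13}` -/

section MainTen

variable {W : Type*} [AddCommGroup W] [Module ℂ W]

/-- **THE `Θ`-SUBALGEBRA THEOREM FOR UNITARY MULTIPLICITIES `(10, b)`, `b` ODD, `b ≤ 13`, `5 ∤ b`, `b ≠ 9`** (Ribet's
Thm. 3 at `(10, n″)`, `n″ ∈ {1, 3, 7, 11, 13}`, classification-free; NEW: `(10, 11)` and `(10, 13)` — the `23`-fold
cell). [cite: Ribet1983, Thm. 3] [cite: Gordon1997, Thm. 6.3 (3) and pp. 18–19] [cite: Deligne1982HodgeCycles, I §3 Prop. 3.4, 3.6] -/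
theorem UnitaryTen.eq_top_of_smul [FiniteDimensional ℂ W] {𝔊 : Submodule ℂ (Module.End ℂ W)}
    (hbr : ∀ Y ∈ 𝔊, ∀ Z ∈ 𝔊, Y * Z - Z * Y ∈ 𝔊)
    (hirr : ∀ U : Submodule ℂ W, (∀ A ∈ 𝔊, ∀ u ∈ U, A u ∈ U) → U = ⊥ ∨ U = ⊤)
    {Θ : Module.End ℂ W} (hΘ : Θ ∈ 𝔊) (hΘΘ : Θ * Θ = 1)
    {P Q : Submodule ℂ W} (hP : ∀ x, x ∈ P ↔ Θ x = x) (hQ : ∀ x, x ∈ Q ↔ Θ x = -x)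
    (hP10 : Module.finrank ℂ P = 10) (hQodd : Odd (Module.finrank ℂ Q)) (hQ5 : ¬ 5 ∣ Module.finrank ℂ Q)
    (hQ9 : Module.finrank ℂ Q ≠ 9) (hQ13 : Module.finrank ℂ Q ≤ 13)
    {s : W → W → ℂ} (hadd : ∀ x y z, s (x + y) z = s x z + s y z)
    (hsmul : ∀ (c : ℂ) (x y : W), s (c • x) y = c * s x y) (hsymm : ∀ x y, s y x = starRingEnd ℂ (s x y))
    (hPQ : ∀ p ∈ P, ∀ q ∈ Q, s p q = 0) (hdefP : ∀ p ∈ P, s p p = 0 → p = 0) (hdefQ : ∀ q ∈ Q, s q q = 0 → q = 0)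
    (hadj : ∀ X ∈ 𝔊, ∃ Y ∈ 𝔊, ∀ x y, s (X x) y = s x (Y y)) : 𝔊 = ⊤ := by
  obtain ⟨k, hk⟩ := hQodd
  by_cases hb1 : Module.finrank ℂ Q = 1
  · exact UnitaryThreeCoprime.eq_top_of_finrank_eq_one hbr hirr hΘ hΘΘ hP hQ (by omega) hb1
  by_cases hb3 : Module.finrank ℂ Q = 3
  · exact UnitaryThreeCoprime.eq_top' hbr hirr hΘ hΘΘ hP hQ (by rw [hP10]; decide) hb3 hadd hsymm hPQ hdefP hdefQ
      hadj
  by_cases hb7 : Module.finrank ℂ Q = 7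
  · exact UnitarySeven.eq_top_of_smul' hbr hirr hΘ hΘΘ hP hQ (by rw [hP10]; decide) hb7 hadd hsmul hsymm hPQ hdefP
      hdefQ hadj
  by_cases hb11 : Module.finrank ℂ Q = 11
  · -- one Euclid step onto `(10 | 1)`
    refine UnitaryCoprimeStep.eq_top_of_onto_of_core hbr hirr hΘ hΘΘ hP hQ hP10 hb11 (by norm_num) (by norm_num) hadd
      hsymm hPQ hdefP hdefQ hadj ?_ ?_
    · exact UnitaryTen.exists_raise_onto_ten_of_smul hbr hirr hΘ hΘΘ hP hQ hP10 (Or.inl hb11) hadd hsmul hsymm hPQ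
        hdefP hdefQ hadj
    · intro 𝔩 ι P' Q' hbr𝔩 hirr𝔩 hι hιι hP' hQ' hfinP' hfinQ' _ _ _ _
      exact UnitaryThreeCoprime.eq_top_of_finrank_eq_one hbr𝔩 hirr𝔩 hι hιι hP' hQ' (by rw [hfinP']; norm_num) (by omega)
  have hb13 : Module.finrank ℂ Q = 13 := by omega
  -- one Euclid step onto `(10 | 3)`
  refine UnitaryCoprimeStep.eq_top_of_onto_of_core hbr hirr hΘ hΘΘ hP hQ hP10 hb13 (by norm_num) (by norm_num) hadd
    hsymm hPQ hdefP hdefQ hadj ?_ ?_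
  · exact UnitaryTen.exists_raise_onto_ten_of_smul hbr hirr hΘ hΘΘ hP hQ hP10 (Or.inr (Or.inl hb13)) hadd hsmul hsymm
      hPQ hdefP hdefQ hadj
  · intro 𝔩 ι P' Q' hbr𝔩 hirr𝔩 hι hιι hP' hQ' hfinP' hfinQ' hP'Q' hdefP' hdefQ' hadj𝔩
    exact UnitaryThreeCoprime.eq_top' hbr𝔩 hirr𝔩 hι hιι hP' hQ' (by rw [hfinP']; decide) (by omega)
      (s := fun x y : Q => s (x : W) y) (fun x y z => by simp only [Submodule.coe_add, hadd])
      (fun x y => hsymm x y) hP'Q' hdefP' hdefQ' hadj𝔩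

/-- **The mirror `(b | 10)`, `b ∈ {1, 3, 7, 11, 13}`** (apply `eq_top_of_smul` to `−Θ`). [cite: Ribet1983, Thm. 3]
[cite: Gordon1997, Thm. 6.3 (3)] -/
theorem UnitaryTen.eq_top_of_smul' [FiniteDimensional ℂ W] {𝔊 : Submodule ℂ (Module.End ℂ W)}
    (hbr : ∀ Y ∈ 𝔊, ∀ Z ∈ 𝔊, Y * Z - Z * Y ∈ 𝔊)
    (hirr : ∀ U : Submodule ℂ W, (∀ A ∈ 𝔊, ∀ u ∈ U, A u ∈ U) → U = ⊥ ∨ U = ⊤)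
    {Θ : Module.End ℂ W} (hΘ : Θ ∈ 𝔊) (hΘΘ : Θ * Θ = 1)
    {P Q : Submodule ℂ W} (hP : ∀ x, x ∈ P ↔ Θ x = x) (hQ : ∀ x, x ∈ Q ↔ Θ x = -x)
    (hPodd : Odd (Module.finrank ℂ P)) (hP5 : ¬ 5 ∣ Module.finrank ℂ P) (hP9 : Module.finrank ℂ P ≠ 9)
    (hP13 : Module.finrank ℂ P ≤ 13) (hQ10 : Module.finrank ℂ Q = 10)
    {s : W → W → ℂ} (hadd : ∀ x y z, s (x + y) z = s x z + s y z)
    (hsmul : ∀ (c : ℂ) (x y : W), s (c • x) y = c * s x y) (hsymm : ∀ x y, s y x = starRingEnd ℂ (s x y))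
    (hPQ : ∀ p ∈ P, ∀ q ∈ Q, s p q = 0) (hdefP : ∀ p ∈ P, s p p = 0 → p = 0) (hdefQ : ∀ q ∈ Q, s q q = 0 → q = 0)
    (hadj : ∀ X ∈ 𝔊, ∃ Y ∈ 𝔊, ∀ x y, s (X x) y = s x (Y y)) : 𝔊 = ⊤ := by
  have hnΘ : -Θ ∈ 𝔊 := Submodule.neg_mem _ hΘ
  have hnΘΘ : (-Θ) * (-Θ) = 1 := by rw [neg_mul_neg, hΘΘ]
  exact UnitaryTen.eq_top_of_smul hbr hirr hnΘ hnΘΘ (P := Q) (Q := P)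
    (fun x => by rw [hQ, LinearMap.neg_apply, neg_eq_iff_eq_neg]) (fun x => by rw [hP, LinearMap.neg_apply, neg_inj])
    hQ10 hPodd hP5 hP9 hP13 hadd hsmul hsymm (fun q hq p hp => by rw [hsymm, hPQ p hp q hq, map_zero]) hdefQ hdefP hadj

end MainTen

end HodgeStructure

end Literature.AlgebraicGeometry.Motives

end
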